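import Literature.Topology.FourManifolds.EuclideanBoundaryCollarFlow
import Literature.Geometry.Riemannian.MeanConvexSurrounding

/-!
# Lawson–Michelsohn (1984), Thm. 6.1: the endgame — from a mean-convex core level function to
# the strong isotopy

Topic `Geometry/Riemannian` (fact seat
`provefact-Literature.Geometry.Riemannian.LawsonMichelsohn1984_surrounding`).  Everything here
is **proved**; no named fact is introduced.

The conclusion of `LawsonMichelsohn1984_surrounding` is a smooth embedding
`Φ : N × [0, 1] → ℝ^{m+1}` (product model with corners) with `Φ(·, 0) = e` and `Φ(N × {1})` the
regular zero set of a function `F'` whose compact sublevel domain `{F' ≤ 0}` is strictly mean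
convex.  This file isolates the last step of the proof of Thm. 6.1 (p. 416: "the region between
`f(N)` and the surrounding hypersurface is a product"): **if the geometric construction provides
a smooth function `g` on `ℝ^{m+1}` without critical points on a compact band `{lo' ≤ g ≤ hi'}`,
`lo' < 0 < 1 < hi'`, with `e(N) = {g = 1}`, `{g ≤ 0}` compact and strictly mean convex along
`{g = 0}`, then the conclusion holds** with `F' = g` and `Φ` the gradient collar of `g` across the
band `[0, 1]` (`exists_euclideanCollarData_of_band`, the regular interval theorem realised in
`ℝ^{m+1}`, and `EuclideanCollarData.isSmoothEmbedding_collarMap`).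

* `surrounding_of_coreLevelFunction` — the step for one datum `(m, N, F, e)`;
* `LawsonMichelsohn1984_surrounding_of_coreLevelFunctions` — hence the fact follows from the
  existence of such core level functions for all data of the fact (the remaining, geometric,
  content of Thms. 3.1 and 6.1: the mean-convex handlebody `X ⊆ D` onto whose complement the
  `1`-thin domain `D` retracts as a product).

## References

* H. B. Lawson, Jr., M.-L. Michelsohn, *Embedding and surrounding with positive mean curvature*,
  Invent. Math. 77 (1984), Thm. 6.1 and its proof (p. 416). [LawsonMichelsohn1984]
* J. Milnor, *Morse theory* (1963), Thm. 3.1. [Milnor1963]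
-/

noncomputable section

open scoped Manifold ContDiff
open Set Function Literature.Topology.FourManifolds

namespace Literature.Geometry.Riemannian

/-- **The core-level-function form of the data the geometric construction must deliver**, for one
datum of `LawsonMichelsohn1984_surrounding`: a smooth clock `g : ℝ^{m+1} → ℝ` without critical
points on a compact band `{lo' ≤ g ≤ hi'}`, `lo' < 0 < 1 < hi'`, with `e(N) = {g = 1}`, and a
smooth defining function `F'` of the compact core, `{F' = 0} = {g = 0}`, regular along its zero set
and satisfying the mean-convexity clause of the fact there. [cite: LawsonMichelsohn1984, proof of Thm. 6.1] -/
theorem surrounding_of_coreLevelFunction {m : ℕ} (hm : 1 ≤ m) (N : Type) [TopologicalSpace N]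
    [ChartedSpace (EuclideanSpace ℝ (Fin m)) N] [IsManifold (𝓡 m) ∞ N] [Nonempty N]
    (e : N → EuclideanSpace ℝ (Fin (m + 1))) (g F' : EuclideanSpace ℝ (Fin (m + 1)) → ℝ)
    (he : Manifold.IsSmoothEmbedding (𝓡 m) 𝓘(ℝ, EuclideanSpace ℝ (Fin (m + 1))) ∞ e)
    (hg : ContDiff ℝ ∞ g) {lo' hi' : ℝ} (hlo : lo' < 0) (hhi : 1 < hi')
    (hband : IsCompact {x | g x ∈ Icc lo' hi'})
    (hreg : ∀ x, g x ∈ Icc lo' hi' → fderiv ℝ g x ≠ 0) (hrange : range e = {x | g x = 1})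
    (hF' : ContDiff ℝ ∞ F') (hcompact : IsCompact {x | F' x ≤ 0})
    (hF'reg : ∀ x, F' x = 0 → fderiv ℝ F' x ≠ 0) (hzero : {x | F' x = 0} = {x | g x = 0})
    (hconvex : ∀ x, F' x = 0 → ∀ v : Fin m → EuclideanSpace ℝ (Fin (m + 1)), Orthonormal ℝ v →
      (∀ i, fderiv ℝ F' x (v i) = 0) → 0 < ∑ i, iteratedFDeriv ℝ 2 F' x ![v i, v i]) :
    ∃ (Φ : N × unitInterval → EuclideanSpace ℝ (Fin (m + 1)))
      (F' : EuclideanSpace ℝ (Fin (m + 1)) → ℝ),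
      Manifold.IsSmoothEmbedding ((𝓡 m).prod (𝓡∂ 1)) 𝓘(ℝ, EuclideanSpace ℝ (Fin (m + 1))) ∞ Φ ∧
      (∀ p : N, Φ (p, 0) = e p) ∧ ContDiff ℝ ∞ F' ∧ IsCompact {x | F' x ≤ 0} ∧
      (∀ x, F' x = 0 → fderiv ℝ F' x ≠ 0) ∧ range (fun p : N => Φ (p, 1)) = {x | F' x = 0} ∧
      ∀ x, F' x = 0 → ∀ v : Fin m → EuclideanSpace ℝ (Fin (m + 1)), Orthonormal ℝ v →
        (∀ i, fderiv ℝ F' x (v i) = 0) → 0 < ∑ i, iteratedFDeriv ℝ 2 F' x ![v i, v i] := by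
  obtain ⟨n, rfl⟩ : ∃ n, m = n + 1 := ⟨m - 1, by omega⟩
  obtain ⟨θ, D, -, -, -, -, -, -, -, hD0, -, -, -, hlevels⟩ :=
    exists_euclideanCollarData_of_band (n := n) hg hlo one_pos hhi hband hreg he hrange
  refine ⟨D.collarMap, F', D.isSmoothEmbedding_collarMap, fun p => hD0 p, hF', hcompact,
    hF'reg, ?_, hconvex⟩
  have h1 : (1 : ℝ) - (1 - 0) * 1 ∈ Icc lo' hi' := ⟨by linarith, by linarith⟩
  have key := hlevels 1 h1
  have h0 : (1 : ℝ) - (1 - 0) * 1 = 0 := by norm_num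
  rw [h0] at key
  rw [hzero]
  exact key

/-- **Lawson–Michelsohn's Thm. 6.1 reduces to the construction of core level functions.**  If for
every datum of `LawsonMichelsohn1984_surrounding` (a `1`-thin compact regular domain `{F ≤ 0}` of
`ℝ^{m+1}`, `m ≥ 4`, with boundary `e(N)`) there are a smooth clock `g` without critical points on
a compact band `{lo' ≤ g ≤ hi'}`, `lo' < 0 < 1 < hi'`, with `e(N) = {g = 1}`, and a smooth
defining function `F'` of a compact core with `{F' = 0} = {g = 0}`, regular and strictly mean
convex along its zero set — the output of the handle-by-handle surrounding construction
(Thm. 3.1) applied to a handle decomposition of `{F ≤ 0}` without handles of index `≥ m`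
(`exists_isMorseFunction_domain`) together with the product structure of the complement — then
`LawsonMichelsohn1984_surrounding` holds. [cite: LawsonMichelsohn1984, Thms. 3.1, 6.1] -/
theorem LawsonMichelsohn1984_surrounding_of_coreLevelFunctions
    (hcore : ∀ (m : ℕ), 4 ≤ m → ∀ (N : Type) [TopologicalSpace N] [T2Space N]
      [SecondCountableTopology N] [CompactSpace N] [ConnectedSpace N]
      [ChartedSpace (EuclideanSpace ℝ (Fin m)) N] [IsManifold (𝓡 m) ∞ N]
      (F : EuclideanSpace ℝ (Fin (m + 1)) → ℝ) (e : N → EuclideanSpace ℝ (Fin (m + 1))),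
      ContDiff ℝ ∞ F → IsCompact {x | F x ≤ 0} → (∀ x, F x = 0 → fderiv ℝ F x ≠ 0) →
      Manifold.IsSmoothEmbedding (𝓡 m) 𝓘(ℝ, EuclideanSpace ℝ (Fin (m + 1))) ∞ e →
      range e = {x | F x = 0} →
      RelPiOneTrivial {x : EuclideanSpace ℝ (Fin (m + 1)) // F x ≤ 0} {p | F p.1 = 0} →
      ∃ (g F' : EuclideanSpace ℝ (Fin (m + 1)) → ℝ) (lo' hi' : ℝ), ContDiff ℝ ∞ g ∧ lo' < 0 ∧
        1 < hi' ∧ IsCompact {x | g x ∈ Icc lo' hi'} ∧ (∀ x, g x ∈ Icc lo' hi' → fderiv ℝ g x ≠ 0) ∧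
        range e = {x | g x = 1} ∧ ContDiff ℝ ∞ F' ∧ IsCompact {x | F' x ≤ 0} ∧
        (∀ x, F' x = 0 → fderiv ℝ F' x ≠ 0) ∧ {x | F' x = 0} = {x | g x = 0} ∧
        ∀ x, F' x = 0 → ∀ v : Fin m → EuclideanSpace ℝ (Fin (m + 1)), Orthonormal ℝ v →
          (∀ i, fderiv ℝ F' x (v i) = 0) → 0 < ∑ i, iteratedFDeriv ℝ 2 F' x ![v i, v i]) :
    LawsonMichelsohn1984_surrounding := by
  intro m hm N _ _ _ _ _ _ _ F e hF hD hreg he hrange h1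
  obtain ⟨g, F', lo', hi', hg, hlo, hhi, hband, hgreg, hrange', hF', hcompact, hF'reg, hzero,
    hconvex⟩ := hcore m hm N F e hF hD hreg he hrange h1
  haveI : Nonempty N := ConnectedSpace.toNonempty
  exact surrounding_of_coreLevelFunction (by omega) N e g F' he hg hlo hhi hband hgreg hrange'
    hF' hcompact hF'reg hzero hconvex

end Literature.Geometry.Riemannian

end
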